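import Mathlib
import HarnessLib
import Summits.Ventures.LatticeQCDFlow.Exactness.NCMCGeneralSpaceConditionalMeanCLT
import Summits.Ventures.LatticeQCDFlow.Exactness.NCMCGeneralSpaceEstimatorConsistency
import Summits.Ventures.LatticeQCDFlow.Exactness.NCMCGeneralSpaceRestartChainEveryStart

/-!
# The reweighting lane along CORRELATED starts: `√n (Σ e^{−W_i} f(end_i) / Σ e^{−W_i} − Z₁⁻¹∫ f dν₁) ⇒ N(0, σ²_c / (Z₁/Z₀)²)` along the restart chain from EVERY initial record law

HONEST FRAMING: exact (Metropolis-corrected) sampling algorithms for lattice gauge theory;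
figures of merit are autocorrelation/cost numbers at stated couplings and volumes; no
continuum-physics claim.

Venture `LatticeQCDFlow` (cell pub-lqcd), topic `Exactness`; FANOUT row 13 (`eng-snf`, GEN-22).
NEW WORK of the cell, not a published result; no definition is introduced; nothing is cited as a
fact.  `latflow-snf`'s `estimators.reweight` reports target-ensemble expectations as Jarzynski-
reweighted end-point averages `R_n = Σ_{i<n} e^{−W_i} f(end_i) / Σ_{i<n} e^{−W_i}`.  GEN-12 typed
their CLT for INDEPENDENT evolutions (`NCMCGeneralSpaceReweightedCLT`), GEN-16/18 their almost-sure
convergence along the restart chain of CORRELATED launches from every start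
(`CrooksPair.tendsto_reweighted_restartChain_anyLaw`); this file is the CLT along the restart chain,
the reweighting companion of `NCMCGeneralSpaceRestartChainCLT.lean`: for bounded-below work and a
bounded end-point observable `f`, the centred numerator observable
`c(ω) = e^{−W(ω)} (f(e ω) − Z₁⁻¹∫ f dν₁)` is bounded with `E_F c = 0`
(`CrooksPair.integral_exp_neg_work_mul_comp_end`), GEN-19's Doeblin-power CLT from every initial
law applies to it on the one-step-minorised restart kernel (GEN-18), the mean weight converges to
`Z₁/Z₀ > 0` almost surely from every initial record law, and the exact ratio identity
`√n (R_n − μ_f) = ((√n)⁻¹ Σ c_i) · (Ȳ_n)⁻¹` (GEN-19 `ratio_identity`) with Slutsky's theorem finishes.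

## Content (Crooks pair between finite weights, `Z₀, Z₁ ≠ 0`; `K` Markov, `ν₀`-invariant,
## `m ≤ K(z, ·)` ∀ `z`, `m` finite non-zero; `−B ≤ W`; `|f| ≤ C_f` measurable;
## `μ_f = Z₁⁻¹ ∫ f dν₁`; `R = (κF ∘ₖ K).comap s`; `P_F = fwdPathLaw ν₀ κF`)

* **`CrooksPair.tendstoInDistribution_reweighted_restartChain`** — for EVERY initial record law `μ₀`
  and every `Y ~ N(0, σ²_c / (Z₁/Z₀)²)`,
  `σ²_c = ∫ c² dP_F + 2 Σ_{k≥0} ∫ c · (kop R)^[k+1] c dP_F`: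
  `√n (R_n − μ_f) ⇒ Y` under the chain law of the records;
  **`…_everyStart`** — first record launched from ANY configuration `x`.

Reading (value-free): the honest large-`n` error bar of a reweighted observable from `n` correlated
launches is `√(σ²_c e^{2ΔF}/n)` — the Green–Kubo variance of the dissipation-weighted centred
observable along THIS chain.  NOT CLAIMED: unbounded `f` or work; `σ²_c > 0`; a consistent estimator
of `σ²_c` (the natural plug-in series uses `R_n` in place of `μ_f`); anything numerical.
-/

namespace Summit.Ventures.LatticeQCDFlow.Exactness.GeneralNCMC

open MeasureTheory ProbabilityTheory Set Filter Finset
open scoped ENNReal Topology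

variable {Ω E : Type*} [MeasurableSpace Ω] [MeasurableSpace E]

namespace CrooksPair

variable {ν₀ ν₁ : Measure Ω} [IsFiniteMeasure ν₀] [IsFiniteMeasure ν₁] {κF κR : Kernel Ω E}
  [IsMarkovKernel κF] [IsMarkovKernel κR] {s e : E → Ω} {W : E → ℝ}

/-- **THE CLT OF REWEIGHTED END-POINT AVERAGES ALONG CORRELATED STARTS, FROM EVERY INITIAL RECORD LAW.**
Crooks pair with `Z₀ ≠ 0`, `Z₁ ≠ 0`; bounded-below work `−B ≤ W`; `|f| ≤ C_f` measurable;
`K` Markov, `ν₀`-invariant, `m ≤ K(z, ·)` for all `z` (`m` finite, `m(Ω) ≠ 0`); `μ_f = Z₁⁻¹ ∫ f dν₁`,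
`c = e^{−W} (f ∘ e − μ_f)`.  For every real random variable `Y` with law `N(0, σ²_c / (Z₁/Z₀)²)`:
`√n (Σ_{i<n} e^{−W_i} f(end_i) / Σ_{i<n} e^{−W_i} − μ_f) ⇒ Y` under the chain law of the records. -/
theorem tendstoInDistribution_reweighted_restartChain (K : Kernel Ω Ω) [IsMarkovKernel K]
    (h0 : ν₀ univ ≠ 0) (h1 : ν₁ univ ≠ 0) (hK : Kernel.Invariant K ν₀)
    (h : CrooksPair ν₀ ν₁ κF κR s e W) {m : Measure Ω} [IsFiniteMeasure m] (hm0 : m univ ≠ 0)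
    (hmin : ∀ z, m ≤ K z) {B : ℝ} (hB : ∀ ω, -B ≤ W ω) {f : Ω → ℝ} (hfm : Measurable f) {Cf : ℝ}
    (hCf : ∀ y, |f y| ≤ Cf) (μ₀ : Measure E) [IsProbabilityMeasure μ₀]
    {Ω' : Type*} [MeasurableSpace Ω'] {P' : Measure Ω'} [IsProbabilityMeasure P'] {Y : Ω' → ℝ}
    (hY : HasLaw Y (gaussianReal 0 (Real.toNNReal
      (((∫ ω, (Real.exp (-W ω) * (f (e ω) - ((ν₁ univ)⁻¹).toReal * ∫ y, f y ∂ν₁)) ^ 2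
          ∂(fwdPathLaw ν₀ κF))
      + 2 * ∑' k, ∫ ω, (Real.exp (-W ω) * (f (e ω) - ((ν₁ univ)⁻¹).toReal * ∫ y, f y ∂ν₁))
        * (Scoring.kop ((κF ∘ₖ K).comap s h.measurable_s))^[k + 1]
            (fun ω => Real.exp (-W ω) * (f (e ω) - ((ν₁ univ)⁻¹).toReal * ∫ y, f y ∂ν₁)) ω
          ∂(fwdPathLaw ν₀ κF))
        / ((ν₀ univ)⁻¹ * ν₁ univ).toReal ^ 2))) P')
    [IsProbabilityMeasure (Kernel.trajMeasure (X := fun _ : ℕ => E) μ₀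
        (fun n : ℕ => ((κF ∘ₖ K).comap s h.measurable_s).comap
          (fun hh : (j : ↥(Finset.Iic n)) → E => hh ⟨n, Finset.mem_Iic.2 le_rfl⟩)
          (measurable_pi_apply _)))] :
    TendstoInDistribution (fun (n : ℕ) (ω : ℕ → E) =>
        Real.sqrt n * ((∑ i ∈ range n, Real.exp (-W (ω i)) * f (e (ω i))) /
          (∑ i ∈ range n, Real.exp (-W (ω i))) - ((ν₁ univ)⁻¹).toReal * ∫ y, f y ∂ν₁))
      atTop Y (fun _ => Kernel.trajMeasure (X := fun _ : ℕ => E) μ₀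
        (fun n : ℕ => ((κF ∘ₖ K).comap s h.measurable_s).comap
          (fun hh : (j : ↥(Finset.Iic n)) → E => hh ⟨n, Finset.mem_Iic.2 le_rfl⟩)
          (measurable_pi_apply _))) P' := by
  set P := Kernel.trajMeasure (X := fun _ : ℕ => E) μ₀
    (fun n : ℕ => ((κF ∘ₖ K).comap s h.measurable_s).comap
      (fun hh : (j : ↥(Finset.Iic n)) → E => hh ⟨n, Finset.mem_Iic.2 le_rfl⟩)
      (measurable_pi_apply _)) with hP
  haveI := isProbabilityMeasure_fwdPathLaw ν₀ h0 κF
  haveI := isProbabilityMeasure_normalised_bind_kernel κF hm0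
  set θ : ℝ := ((ν₀ univ)⁻¹ * ν₁ univ).toReal with hθdef
  set μf : ℝ := ((ν₁ univ)⁻¹).toReal * ∫ y, f y ∂ν₁ with hμf
  have hθ : 0 < θ :=
    ENNReal.toReal_pos (mul_ne_zero (ENNReal.inv_ne_zero.2 (measure_ne_top ν₀ univ)) h1)
      (ENNReal.mul_ne_top (ENNReal.inv_ne_top.2 h0) (measure_ne_top ν₁ univ))
  have hCf0 : 0 ≤ Cf := (abs_nonneg _).trans (hCf (s (Classical.choice
    (nonempty_of_isProbabilityMeasure (fwdPathLaw ν₀ κF)))))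
  -- the centred numerator observable
  set c : E → ℝ := fun ω => Real.exp (-W ω) * (f (e ω) - μf) with hc
  have hcm : Measurable c :=
    (Real.measurable_exp.comp h.measurable_W.neg).mul ((hfm.comp h.measurable_e).sub measurable_const)
  have hμfb : |μf| ≤ Cf := by
    rw [hμf, abs_mul, ENNReal.toReal_inv, abs_inv, abs_of_nonneg ENNReal.toReal_nonneg]
    rcases eq_or_ne (ν₁ univ).toReal 0 with hz | hz
    · rw [hz, inv_zero, zero_mul]; exact hCf0
    · rw [inv_mul_le_iff₀ (lt_of_le_of_ne ENNReal.toReal_nonneg (Ne.symm hz)), ← Real.norm_eq_abs]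
      calc ‖∫ y, f y ∂ν₁‖ ≤ Cf * ν₁.real univ :=
            norm_integral_le_of_norm_le_const (Eventually.of_forall fun y => by
              rw [Real.norm_eq_abs]; exact hCf y)
        _ = (ν₁ univ).toReal * Cf := by rw [measureReal_def, mul_comm]
  have hcb : ∀ ω, |c ω| ≤ Real.exp B * (2 * Cf) := fun ω => by
    rw [hc]
    dsimp only
    rw [abs_mul, abs_of_pos (Real.exp_pos _)]
    refine mul_le_mul (Real.exp_le_exp.2 (by linarith [hB ω])) ?_ (abs_nonneg _) (Real.exp_pos _).le
    calc |f (e ω) - μf| ≤ |f (e ω)| + |μf| := abs_sub _ _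
      _ ≤ Cf + Cf := add_le_add (hCf _) hμfb
      _ = 2 * Cf := by ring
  -- `E_F c = 0`
  have hc0 : ∫ ω, c ω ∂(fwdPathLaw ν₀ κF) = 0 := by
    have key := h.integral_exp_neg_work_mul_comp_end (f := fun y => f y - μf)
      (hfm.sub measurable_const).aestronglyMeasurable
    have hint : ∫ y, (f y - μf) ∂ν₁ = ∫ y, f y ∂ν₁ - ν₁.real univ * μf := by
      rw [integral_sub (Scoring.integrable_of_bounded ν₁ hfm hCf) (integrable_const _),
        integral_const, smul_eq_mul]
    rw [hc]
    dsimp only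
    rw [key, hint, hμf, measureReal_def]
    simp only [ENNReal.toReal_inv]
    rcases eq_or_ne (ν₁ univ).toReal 0 with hz | hz
    · have : ∫ y, f y ∂ν₁ = 0 := by
        have hν : ν₁ = 0 := by
          rw [← Measure.measure_univ_eq_zero]
          exact (ENNReal.toReal_eq_zero_iff _).1 hz |>.resolve_right (measure_ne_top _ _)
        rw [hν, integral_zero_measure]
      rw [this, hz]; ring
    · field_simp
      ring
  -- the numerator CLT for the limit variable `θ · Y ~ N(0, σ²_c)`
  have hYX : HasLaw (fun ω' => θ * Y ω') (gaussianReal 0 (Real.toNNReal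
      ((∫ ω, (c ω - ∫ z, c z ∂(fwdPathLaw ν₀ κF)) ^ 2 ∂(fwdPathLaw ν₀ κF))
        + 2 * ∑' k, ∫ ω, (c ω - ∫ z, c z ∂(fwdPathLaw ν₀ κF))
          * (Scoring.kop ((κF ∘ₖ K).comap s h.measurable_s))^[k + 1]
            (fun ω => c ω - ∫ z, c z ∂(fwdPathLaw ν₀ κF)) ω ∂(fwdPathLaw ν₀ κF)))) P' := by
    simp_rw [hc0, sub_zero]
    set V : ℝ := (∫ ω, c ω ^ 2 ∂(fwdPathLaw ν₀ κF))
      + 2 * ∑' k, ∫ ω, c ω * (Scoring.kop ((κF ∘ₖ K).comap s h.measurable_s))^[k + 1] c ω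
        ∂(fwdPathLaw ν₀ κF) with hV
    have hg := gaussianReal_const_mul hY θ
    rw [mul_zero] at hg
    have hnn : NNReal.mk (θ ^ 2) (sq_nonneg _) * (V / θ ^ 2).toNNReal = V.toNNReal := by
      rw [show V = θ ^ 2 * (V / θ ^ 2) by field_simp, Real.toNNReal_mul (sq_nonneg _)]
      rw [show θ ^ 2 * (V / θ ^ 2) = V by field_simp]
      congr 1
      apply NNReal.eq
      rw [NNReal.coe_mk, Real.coe_toNNReal _ (sq_nonneg _)]
    rw [hnn] at hg
    exact hg
  have hX := tendstoInDistribution_timeAverage_of_nHit (h.invariant_restartKernel K hK) hm0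
    (restartKernel_nHit_one_minorised K h hm0 hmin) Nat.one_pos hcm hcb μ₀ hYX
  simp_rw [hc0, sub_zero] at hX
  -- the denominator: `(Ȳ_n)⁻¹ → θ⁻¹` almost surely, hence in measure
  have hwm : Measurable fun ε => Real.exp (-W ε) := Real.measurable_exp.comp h.measurable_W.neg
  have hBm : ∀ n : ℕ, Measurable fun ω : ℕ → E =>
      ((∑ i ∈ range n, Real.exp (-W (ω i))) / n)⁻¹ := fun n =>
    ((Finset.measurable_sum _ fun i _ => hwm.comp (measurable_pi_apply i)).div_const _).inv
  have hmean := h.tendsto_sampleMean_restartChain_anyLaw K h0 hK hm0 hmin μ₀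
  rw [← hP] at hmean
  have hBc : TendstoInMeasure P (fun (n : ℕ) (ω : ℕ → E) =>
      ((∑ i ∈ range n, Real.exp (-W (ω i))) / n)⁻¹) atTop (fun _ => θ⁻¹) := by
    refine tendstoInMeasure_of_tendsto_ae (fun n => (hBm n).aestronglyMeasurable) ?_
    filter_upwards [hmean] with ω hω
    exact hω.inv₀ hθ.ne'
  -- Slutsky
  have hXB := hX.continuous_comp_prodMk_of_tendstoInMeasure_const
    (g := fun p : ℝ × ℝ => p.1 * p.2) (by fun_prop) hBc (fun n => (hBm n).aemeasurable)
  have hlim : (fun ω' => (fun p : ℝ × ℝ => p.1 * p.2) (θ * Y ω', θ⁻¹)) = Y := by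
    funext ω'
    dsimp only
    rw [mul_comm θ (Y ω'), mul_assoc, mul_inv_cancel₀ hθ.ne', mul_one]
  rw [hlim] at hXB
  -- the ratio statistic IS the Slutsky product, surely (the weights are positive)
  refine hXB.congr (fun n => Eventually.of_forall fun ω => ?_) Filter.EventuallyEq.rfl
  dsimp only
  rcases Nat.eq_zero_or_pos n with hn | hn
  · subst hn; simp
  · have hn' : (0 : ℝ) < n := by exact_mod_cast hn
    have hT : 0 < ∑ i ∈ range n, Real.exp (-W (ω i)) :=
      Finset.sum_pos (fun i _ => Real.exp_pos _) (Finset.nonempty_range_iff.2 hn.ne')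
    have hsum : ∑ i ∈ range n, c (ω i)
        = ∑ i ∈ range n, Real.exp (-W (ω i)) * f (e (ω i))
          - μf * ∑ i ∈ range n, Real.exp (-W (ω i)) := by
      rw [Finset.mul_sum, ← Finset.sum_sub_distrib]
      refine Finset.sum_congr rfl fun i _ => ?_
      rw [hc]
      dsimp only
      ring
    rw [hsum]
    exact (ratio_identity (Real.mul_self_sqrt hn'.le) (Real.sqrt_pos.2 hn').ne' hT.ne').symm

/-- **THE REWEIGHTING LANE'S CLT FROM EVERY INITIAL CONFIGURATION** (first record launched from ANY
configuration `x`, then `K` between launches): `√n (R_n − Z₁⁻¹∫ f dν₁) ⇒ Y` for every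
`Y ~ N(0, σ²_c / (Z₁/Z₀)²)`. -/
theorem tendstoInDistribution_reweighted_restartChain_everyStart (K : Kernel Ω Ω)
    [IsMarkovKernel K] (h0 : ν₀ univ ≠ 0) (h1 : ν₁ univ ≠ 0) (hK : Kernel.Invariant K ν₀)
    (h : CrooksPair ν₀ ν₁ κF κR s e W) {m : Measure Ω} [IsFiniteMeasure m] (hm0 : m univ ≠ 0)
    (hmin : ∀ z, m ≤ K z) {B : ℝ} (hB : ∀ ω, -B ≤ W ω) {f : Ω → ℝ} (hfm : Measurable f) {Cf : ℝ}
    (hCf : ∀ y, |f y| ≤ Cf) (x : Ω)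
    {Ω' : Type*} [MeasurableSpace Ω'] {P' : Measure Ω'} [IsProbabilityMeasure P'] {Y : Ω' → ℝ}
    (hY : HasLaw Y (gaussianReal 0 (Real.toNNReal
      (((∫ ω, (Real.exp (-W ω) * (f (e ω) - ((ν₁ univ)⁻¹).toReal * ∫ y, f y ∂ν₁)) ^ 2
          ∂(fwdPathLaw ν₀ κF))
      + 2 * ∑' k, ∫ ω, (Real.exp (-W ω) * (f (e ω) - ((ν₁ univ)⁻¹).toReal * ∫ y, f y ∂ν₁))
        * (Scoring.kop ((κF ∘ₖ K).comap s h.measurable_s))^[k + 1]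
            (fun ω => Real.exp (-W ω) * (f (e ω) - ((ν₁ univ)⁻¹).toReal * ∫ y, f y ∂ν₁)) ω
          ∂(fwdPathLaw ν₀ κF))
        / ((ν₀ univ)⁻¹ * ν₁ univ).toReal ^ 2))) P')
    [IsProbabilityMeasure (Kernel.trajMeasure (X := fun _ : ℕ => E) (κF x)
        (fun n : ℕ => ((κF ∘ₖ K).comap s h.measurable_s).comap
          (fun hh : (j : ↥(Finset.Iic n)) → E => hh ⟨n, Finset.mem_Iic.2 le_rfl⟩)
          (measurable_pi_apply _)))] :
    TendstoInDistribution (fun (n : ℕ) (ω : ℕ → E) =>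
        Real.sqrt n * ((∑ i ∈ range n, Real.exp (-W (ω i)) * f (e (ω i))) /
          (∑ i ∈ range n, Real.exp (-W (ω i))) - ((ν₁ univ)⁻¹).toReal * ∫ y, f y ∂ν₁))
      atTop Y (fun _ => Kernel.trajMeasure (X := fun _ : ℕ => E) (κF x)
        (fun n : ℕ => ((κF ∘ₖ K).comap s h.measurable_s).comap
          (fun hh : (j : ↥(Finset.Iic n)) → E => hh ⟨n, Finset.mem_Iic.2 le_rfl⟩)
          (measurable_pi_apply _))) P' :=
  h.tendstoInDistribution_reweighted_restartChain K h0 h1 hK hm0 hmin hB hfm hCf (κF x) hY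

end CrooksPair

end Summit.Ventures.LatticeQCDFlow.Exactness.GeneralNCMC
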